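import Literature.MathematicalPhysics.QuantumFieldTheory.Balaban1983to89.B9Thm312WholeDirBZ
import Literature.MathematicalPhysics.QuantumFieldTheory.Balaban1983to89.B9Thm312WholeRightStepFrom3131C

/-!
# `Balaban1983to89.B9Thm312WholeDirBC` — [B9] Theorem 3.12∕3.13 (pp. 421–426): the β∕ε-indexed STEP SCHEMA `StepDirB` of rows 20–21 from Theorem 3.3
# for G₀ and the letters, WITH THE INPUT NORM'S LOCALISATION READ ON CARRIER CLASSES (repair «R2-loc» of `B9Thm312WholeDirBZ.stepDirB_of_letters3131LRZ`)

T. Bałaban, *Propagators for lattice gauge theories in a background field*, Commun. Math. Phys. **99** (1985) 389–434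
[`Balaban1985BackgroundPropagators`, "B9"]; [4] = T. Bałaban, *Propagators and renormalization transformations for lattice
gauge theories. II*, Commun. Math. Phys. **96** (1984) 223–250 [`Balaban1984PropagatorsII`].  statement-level skeleton of published
theorems with citation tags; proofs where landed; nothing here is a claim about the Yang–Mills mass gap.

THE LOCATED DEFECT (dag-n06-w3 g2 `B9Letters313IMBLocObstruction.hLIM_pins_false`, dag-n06-d g9; bus 2026-08-28): the engine binder `hlocX` («a
`bHX ε`-localised function vanishes off the fibre `𝔬.blk⁻¹ y′`») is unsatisfiable at the N06 pins, where the input Hölder norm is localised on the CARRIER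
CLASS of `y′` (print's `supp λ ⊂ Δ̃(y′)`; up to `2(d+1)` index bonds per class).  THE REPAIR is [4] (2.52)'s block sum over the class (dag-n06-d
`B9BlockNormClassTransfer`), costing the class multiplicity `m` in θ_I.
* ★★ `stepDirB_of_letters3131LRCZ` — see its docstring; consumed by dag-n06-d's knit layer in place of `stepDirB_of_letters3131LRZ`, the pins supplying
  `Rel := RelB`, `m := 2(d+1)` (`B9CarrierBlockMultiplicity.card_sameCarrier_le_kIdx`), `hRel` (`B9CoRealizesRelAtLetters.dist_eq_of_relB`) and
  `hvanishX ∕ hleX` from the fields of `B9Thm313WholeDirInputBC.Letters313IMBC`.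
HONEST SCOPE.  Bookkeeping ([4] (2.52)–(2.54), Lemma 2.1); Theorem 3.3's entries, the Hölder ∕ mixed letters and the (3.131)∕(3.137) letters remain
hypotheses; count-neutral; N06 NOT discharged; one finite lattice at a time — nothing continuum ∕ ℝ⁴ ∕ OS ∕ mass gap ∕ Clay.  Cell `pub-ymgap` (HUMAN
RULING D-0062), node N06 [B9], bundle F7 rows 20–21, seat `pub-ymgap-dag-n06-l` (g15), 2026-08-28.  NEW file; nothing landed is modified; 0 `def`.
-/

namespace Literature.MathematicalPhysics.QuantumFieldTheory.Balaban1983to89.B9Thm312WholeDirBC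

open Finset B6RandomWalk B6RandomWalkHom B9Thm34Ext B11SectG B9SectDSup B9Thm312Whole B9Thm312WholeLeaf B9Thm312WholeClasses
open B9RWSums343Holder B9RWSums343to347Whole B9RWSums346Schur B9Thm312WholeDir B9Thm313WholeHolder B9Thm313WholeDir
open B9Thm312WholeStepFrom3131 B9Thm312WholeLeftStepFrom3131 B9Thm312WholeStepDirFrom3131 B9Thm312WholeRightStepFrom3131
open B9Thm312WholeDirB B9Thm313WholeZ B9Thm313WholeLeftZ B9Thm313WholeHolderZ B9Thm313WholeDirZ B9Thm312WholeDirBZ B9Thm312WholeRightStepFrom3131C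

noncomputable section

section OneMember

variable {g : B9.Geometry} {B : B9.Backgrounds} {X Y Z W PX PY P : Type}
variable [Fintype X] [Fintype Y] [Fintype Z] [Fintype W] [Fintype PX] [Fintype PY] [Fintype P] [Fintype g.Site]
variable {R₀ : ℝ} {H₀ : Prop}

omit [Fintype Y] [Fintype Z] [Fintype W] [Fintype PX] [Fintype PY] [Fintype P] [Fintype X] [Fintype g.Site] in
/-- Kernel monotonicity: C·e^{−rd} ≦ θ·e^{−δ_K d} for 0 ≦ C ≦ θ, δ_K ≦ r, d ≧ 0. [folklore] -/
private theorem kernel_le_z {C θ r δK d : ℝ} (hC : 0 ≤ C) (hCθ : C ≤ θ) (hδK : δK ≤ r) (hd : 0 ≤ d) :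
    C * Real.exp (-(r * d)) ≤ θ * Real.exp (-(δK * d)) :=
  calc C * Real.exp (-(r * d)) ≤ C * Real.exp (-(δK * d)) :=
      mul_le_mul_of_nonneg_left (Real.exp_le_exp.mpr (neg_le_neg (mul_le_mul_of_nonneg_right hδK hd))) hC
    _ ≤ θ * Real.exp (-(δK * d)) := mul_le_mul_of_nonneg_right hCθ (Real.exp_nonneg _)

omit [Fintype Y] [Fintype P] in
/-- ★★ **THE β∕ε-INDEXED STEP SCHEMA OF ROWS 20–21 FROM THEOREM 3.3 FOR G₀ AND THE LETTERS, INPUT NORM LOCALISED ON CARRIER CLASSES** (repair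
«R2-loc»: `B9Thm312WholeDirBZ.stepDirB_of_letters3131LRZ` with the binders `hdomX ∕ hlocX` — the located «INPUT-LOC CLASS≠FIBRE» defect — replaced by a
class relation `Rel` on the blocks of multiplicity `≤ m`, the class-constancy of the carrier distance `hRel`, and the two TRUE ε-indexed facts `hvanishX`
(fibre pieces of a `bHX ε`-localised function outside the class vanish) ∕ `hleX` (fibre pieces inside the class are dominated by the input norm); the
right-form members go through `B9Thm312WholeRightStepFrom3131C.tDd_of_letters3131RC` (dag-n06-d's class-multiplicity transfer), so the pointwise
domination of θ_I reads `θ_I(ε) ≧ 2(m·B₀L₀ + B_iD(ε))tc`; statement and proof otherwise VERBATIM; conclusion `StepDirB …` UNCHANGED):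
`StepDirB 𝔬 𝔭 Dd Dds R₀ H₀ bHX hlen θD θH θI δK U` from `Thm33G0Dir` + `Thm33G0DirR`, `Letters313HZ`, `Letters313DMZ`, `Thm33G0DirX`, `Thm33G0DivR`,
`Letters3131`, `Letters3131H`, `Letters3131R`, the row sum and `Facts347`, for θ_D ≧ 2(B₀ + κ_H·B₃)tc, θ_H(β) as in the sibling, θ_I(ε) ≧ 2(m·B₀L₀ +
B_iD(ε))tc; rates 0 ≦ δ_K, δ_K + αδ ≦ ρ ≦ δ_T, ρ + σ ≦ min(δ₀, δ₃).
[cite: Balaban1985BackgroundPropagators, Thm 3.12 p.423 + (3.130)–(3.131) pp.421–422 + (3.137)–(3.138) p.423 + Thm 3.3 p.399 + (3.42)–(3.45) pp.397–398 + p.398 (remarks after (3.47)); Balaban1984PropagatorsII, (2.26) p.228 + (2.52) p.232 + (2.54) p.233 + Lemma 2.1 (2.60)–(2.61) p.234] -/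
theorem stepDirB_of_letters3131LRCZ (hG : GeoOK g) {𝔬 : Ops g B X Y Z W} {𝔭 : HolderProbes g B X Y PX PY}
    {Dd Dds : B.Cfg → P → Module.End ℝ (X → ℝ)} {bHX : ℝ → BlockNorm (toB6 g R₀ H₀) (X → ℝ)}
    {bHW : ℝ → BlockNorm (toB6 g R₀ H₀) (W → ℝ)} {bH : BlockNorm (toB6 g R₀ H₀) (W → ℝ)}
    {Ta Ta₂ : B.Cfg → Module.End ℝ (X → ℝ)} {Tb Tb₂ : B.Cfg → (X → ℝ) →ₗ[ℝ] (W → ℝ)}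
    {Ta' Ta₂' : B.Cfg → Module.End ℝ (X → ℝ)} {Tb' Tb₂' : B.Cfg → (W → ℝ) →ₗ[ℝ] (X → ℝ)}
    {U : B.Cfg} {d : ℕ} {δ α L₀ : ℝ} (hF : Facts347 g R₀ H₀ d δ α L₀)
    {B₀ B₃ t δ₀ δ₃ δT ρ σ c θD δK : ℝ} {θH θI Bh Bi : ℝ → ℝ} {Bi2 : ℝ → ℝ → ℝ} {BhD Bx Bq Bx0 BdX BiD BdD : ℝ → ℝ}
    (hrow : RowSum (toB6 g R₀ H₀) σ c) (hc : 0 ≤ c) (hB₀ : 0 ≤ B₀) (hB₃ : 0 ≤ B₃) (ht : 0 ≤ t)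
    (hBh : ∀ β : ℝ, 0 ≤ β → β < 1 → 0 ≤ Bh β) (hBhD : ∀ β : ℝ, 0 ≤ β → β < 1 → 0 ≤ BhD β)
    (hBx : ∀ β : ℝ, 0 ≤ β → β < 1 → 0 ≤ Bx β) (hBx0 : ∀ β : ℝ, 0 ≤ β → β < 1 → 0 ≤ Bx0 β)
    (hBdX : ∀ β : ℝ, 0 ≤ β → β < 1 → 0 ≤ BdX β) (hBiD : ∀ ε : ℝ, 0 < ε → 0 ≤ BiD ε)
    (Rel : g.Site → g.Site → Prop) [DecidableRel Rel] {m : ℝ} (hm : 0 ≤ m)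
    (hmult : ∀ y' : g.Site, ((Finset.univ.filter (fun y'' => Rel y'' y')).card : ℝ) ≤ m)
    (hRel : ∀ a b b' : g.Site, Rel b' b → g.dist a b' = g.dist a b)
    (hρT : ρ ≤ δT) (hρ₀ : ρ + σ ≤ δ₀) (hρ₃ : ρ + σ ≤ δ₃) (hαδ : 0 ≤ α * δ) (hδK0 : 0 ≤ δK) (hδK : δK + α * δ ≤ ρ)
    (hθD : 2 * ((B₀ + bH.κ * B₃) * t * c) ≤ θD)
    (hθH1 : ∀ β : ℝ, 0 ≤ β → β < 1 → 2 * ((Bh β + bH.κ * BhD β) * t * c) ≤ θH β)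
    (hθH2 : ∀ β : ℝ, 0 ≤ β → β < 1 → 2 * ((Bh β + bH.κ * BdX β) * t * c) ≤ θH β)
    (hθH3 : ∀ β : ℝ, 0 ≤ β → β < 1 → 2 * ((Bx0 β + Bx β) * t * c * L₀) ≤ θH β)
    (hθI : ∀ ε : ℝ, 0 < ε → 2 * ((m * B₀ * L₀ + BiD ε) * t * c) ≤ θI ε)
    (h33 : Thm33G0Dir 𝔬 𝔭 Dd Dds R₀ H₀ bHX B₀ Bh Bi Bi2 δ₀ U) (h33R : Thm33G0DirR 𝔬 Dds R₀ H₀ B₀ δ₀ U)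
    {wZ : g.Site → ℝ} {hwZ : ∀ y, 0 < wZ y} (hLH3 : Letters313HZ 𝔬 𝔭 R₀ H₀ hG wZ hwZ bH BhD Bx δ₃ U)
    (hDM : Letters313DMZ 𝔬 𝔭 Dd R₀ H₀ hG wZ hwZ B₃ Bq δ₃ bH U) (hX : Thm33G0DirX 𝔬 𝔭 Dd R₀ H₀ hG.lenle bH Bx0 BdX δ₀ δ₃ U)
    (hdiv : Thm33G0DivR 𝔬 Dds R₀ H₀ hG.lenle bHX bHW BiD BdD δ₀ δ₃ U)
    (hvanishX : ∀ ε : ℝ, 0 < ε → ∀ (y' : g.Site) (μ : X → ℝ), (bHX ε).IsLoc y' μ → ∀ y'' : g.Site, ¬ Rel y'' y' →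
      (BlockNorm.ofBlocks (toB6 g R₀ H₀) 𝔬.blk).cut y'' μ = 0)
    (hleX : ∀ ε : ℝ, 0 < ε → ∀ (y' : g.Site) (μ : X → ℝ), (bHX ε).IsLoc y' μ → ∀ y'' : g.Site, Rel y'' y' →
      (BlockNorm.ofBlocks (toB6 g R₀ H₀) 𝔬.blk).loc y'' ((BlockNorm.ofBlocks (toB6 g R₀ H₀) 𝔬.blk).cut y'' μ) ≤ (bHX ε).loc y' μ)
    (hL : Letters3131 𝔬 Ta Ta₂ Tb Tb₂ R₀ H₀ hG.lenle t δT U) (hLH : Letters3131H 𝔬 Tb Tb₂ R₀ H₀ hG.lenle bH t δT U)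
    (hR : Letters3131R 𝔬 Ta' Ta₂' Tb' Tb₂' R₀ H₀ hG.lenle t δT U) :
    StepDirB 𝔬 𝔭 Dd Dds R₀ H₀ bHX hG.lenle θD θH θI δK U := by
  have hρ : 0 ≤ ρ := by linarith
  have hαρ : α * δ ≤ ρ := by linarith
  have hδKρ : δK ≤ ρ := by linarith
  have hδKρ' : δK ≤ ρ - α * δ := by linarith
  have hL₀ : 0 ≤ L₀ := le_trans (le_trans zero_le_one hF.one_le_L) hF.L_le
  -- the probe members E = Φ^Y_β∇_U, Φ^X_β∇_{U,ν} at β (pointwise θ_H(β))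
  have probe2 : ∀ {F : Type} [AddCommGroup F] [Module ℝ F] {bout : BlockNorm (toB6 g R₀ H₀) F} {EG : (X → ℝ) →ₗ[ℝ] F} {a aD θ : ℝ},
      0 ≤ a → 0 ≤ aD → 2 * ((a + bH.κ * aD) * t * c) ≤ θ →
      HasMaj (cNormR R₀ H₀ 𝔬.blk hG.lenle 0) bout EG (fun a' b => a * Real.exp (-(δ₀ * g.dist a' b))) →
      HasMaj bH bout (EG ∘ₗ 𝔬.Dv U) (fun a' b => aD * Real.exp (-(δ₃ * g.dist a' b))) →
      HasMaj (cNormR R₀ H₀ 𝔬.blk hG.lenle (-2)) bout (EG ∘ₗ 𝔬.Tpi U) (fun a' b => θ * Real.exp (-(δK * g.dist a' b))) ∧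
        HasMaj (cNormR R₀ H₀ 𝔬.blk hG.lenle (-2)) bout (EG ∘ₗ (𝔬.Tpi U + 𝔬.T2 U))
          (fun a' b => θ * Real.exp (-(δK * g.dist a' b))) := by
    intro F _ _ bout EG a aD θ ha haD hθ hE hED
    have hA := probeStep_of_split hG hrow ha haD ht hρ hρT hρ₀ hρ₃ hL.split hE hED hL.ta hLH.tbH
    have hB := probeStep_of_split hG hrow ha haD ht hρ hρT hρ₀ hρ₃ hL.split₂ hE hED hL.ta₂ hLH.tb₂H
    have hK : 0 ≤ (a + bH.κ * aD) * t * c := mul_nonneg (mul_nonneg (add_nonneg ha (mul_nonneg bH.κ_nonneg haD)) ht) hc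
    have hc1 : (a + bH.κ * aD) * t * c ≤ θ := by linarith
    refine ⟨hA.mono fun a' b => kernel_le_z hK hc1 hδKρ (hG.dnn a' b), ((hA.add hB).congr fun μ => ?_).mono fun a' b => ?_⟩
    · simp only [LinearMap.add_apply, LinearMap.comp_apply, map_add]
    · calc (a + bH.κ * aD) * t * c * Real.exp (-(ρ * g.dist a' b)) + (a + bH.κ * aD) * t * c * Real.exp (-(ρ * g.dist a' b))
          = 2 * ((a + bH.κ * aD) * t * c) * Real.exp (-(ρ * g.dist a' b)) := by ring
        _ ≤ θ * Real.exp (-(δK * g.dist a' b)) := kernel_le_z (mul_nonneg (by norm_num) hK) hθ hδKρ (hG.dnn a' b)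
  -- the Φ^X_β member of the step itself at β
  have probeX2 : ∀ β : ℝ, 0 ≤ β → β < 1 →
      HasMaj (cNormR R₀ H₀ 𝔬.blk hG.lenle (-1)) (cNormR R₀ H₀ 𝔭.blkPX hG.lenle (β - 1)) ((𝔭.ΦX U β ∘ₗ 𝔬.G0 U) ∘ₗ 𝔬.Tpi U)
          (fun a' b => θH β * Real.exp (-(δK * g.dist a' b))) ∧
        HasMaj (cNormR R₀ H₀ 𝔬.blk hG.lenle (-1)) (cNormR R₀ H₀ 𝔭.blkPX hG.lenle (β - 1))
          ((𝔭.ΦX U β ∘ₗ 𝔬.G0 U) ∘ₗ (𝔬.Tpi U + 𝔬.T2 U)) (fun a' b => θH β * Real.exp (-(δK * g.dist a' b))) := by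
    intro β hβ0 hβ1
    have hA := probeStepX_of_split hG hF hrow hc (hBx0 β hβ0 hβ1) (hBx β hβ0 hβ1) ht hαρ hαδ hρT hρ₀ hρ₃ hL.split
      (hX.pX0 β hβ0 hβ1) (hLH3.pXDv β hβ0 hβ1) hL.ta hL.tb
    have hB := probeStepX_of_split hG hF hrow hc (hBx0 β hβ0 hβ1) (hBx β hβ0 hβ1) ht hαρ hαδ hρT hρ₀ hρ₃ hL.split₂
      (hX.pX0 β hβ0 hβ1) (hLH3.pXDv β hβ0 hβ1) hL.ta₂ hL.tb₂
    have hK : 0 ≤ (Bx0 β + Bx β) * t * c * L₀ :=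
      mul_nonneg (mul_nonneg (mul_nonneg (add_nonneg (hBx0 β hβ0 hβ1) (hBx β hβ0 hβ1)) ht) hc) hL₀
    have hc1 : (Bx0 β + Bx β) * t * c * L₀ ≤ θH β := by linarith [hθH3 β hβ0 hβ1]
    refine ⟨hA.mono fun a' b => kernel_le_z hK hc1 hδKρ' (hG.dnn a' b), ((hA.add hB).congr fun μ => ?_).mono fun a' b => ?_⟩
    · simp only [LinearMap.add_apply, LinearMap.comp_apply, map_add]
    · calc (Bx0 β + Bx β) * t * c * L₀ * Real.exp (-((ρ - α * δ) * g.dist a' b)) +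
            (Bx0 β + Bx β) * t * c * L₀ * Real.exp (-((ρ - α * δ) * g.dist a' b))
          = 2 * ((Bx0 β + Bx β) * t * c * L₀) * Real.exp (-((ρ - α * δ) * g.dist a' b)) := by ring
        _ ≤ θH β * Real.exp (-(δK * g.dist a' b)) := kernel_le_z (mul_nonneg (by norm_num) hK) (hθH3 β hβ0 hβ1) hδKρ' (hG.dnn a' b)
  -- the right-form members at ε (pointwise θ_I(ε))
  have hright := fun (μ : P) (ε : ℝ) (hε : 0 < ε) =>
    tDd_of_letters3131RC hG hF hrow hB₀ ht hBiD hαρ hαδ hρT hρ₀ h33R.e2d Rel hm hmult hRel hvanishX hleX hdiv hR μ ε hε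
  have hKI : ∀ ε : ℝ, 0 < ε → 0 ≤ (m * B₀ * L₀ + BiD ε) * t * c := fun ε hε =>
    mul_nonneg (mul_nonneg (add_nonneg (mul_nonneg (mul_nonneg hm hB₀) hL₀) (hBiD ε hε)) ht) hc
  refine
    { pY := fun β hβ0 hβ1 => (probe2 (hBh β hβ0 hβ1) (hBhD β hβ0 hβ1) (hθH1 β hβ0 hβ1)
        (hasMaj_probe_cNormR_of_hom hG (hBh β hβ0 hβ1) (h33.h43L β hβ0 hβ1)) (hLH3.pYDH β hβ0 hβ1)).1
      pY1 := fun β hβ0 hβ1 => (probe2 (hBh β hβ0 hβ1) (hBhD β hβ0 hβ1) (hθH1 β hβ0 hβ1)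
        (hasMaj_probe_cNormR_of_hom hG (hBh β hβ0 hβ1) (h33.h43L β hβ0 hβ1)) (hLH3.pYDH β hβ0 hβ1)).2
      pX := fun β hβ0 hβ1 => (probeX2 β hβ0 hβ1).1
      pX1 := fun β hβ0 hβ1 => (probeX2 β hβ0 hβ1).2
      sDd := fun ν => (stepDd_of_letters3131 hG hrow hc hB₀ hB₃ ht hρ hρT hρ₀ hρ₃ hθD hδKρ h33.e1d hDM.dgDHd hL hLH ν).1
      sDd1 := fun ν => (stepDd_of_letters3131 hG hrow hc hB₀ hB₃ ht hρ hρT hρ₀ hρ₃ hθD hδKρ h33.e1d hDM.dgDHd hL hLH ν).2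
      pXd := fun ν β hβ0 hβ1 => (probe2 (hBh β hβ0 hβ1) (hBdX β hβ0 hβ1) (hθH2 β hβ0 hβ1)
        (hasMaj_probe_cNormR_of_hom hG (hBh β hβ0 hβ1) (h33.h43d ν β hβ0 hβ1)) (hX.pXdDH ν β hβ0 hβ1)).1
      pXd1 := fun ν β hβ0 hβ1 => (probe2 (hBh β hβ0 hβ1) (hBdX β hβ0 hβ1) (hθH2 β hβ0 hβ1)
        (hasMaj_probe_cNormR_of_hom hG (hBh β hβ0 hβ1) (h33.h43d ν β hβ0 hβ1)) (hX.pXdDH ν β hβ0 hβ1)).2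
      tDd := fun μ ε hε => by
        have hc1 : (m * B₀ * L₀ + BiD ε) * t * c ≤ θI ε := by linarith [hθI ε hε, hKI ε hε]
        exact (hright μ ε hε).1.mono fun a b => kernel_le_z (hKI ε hε) hc1 hδKρ' (hG.dnn a b)
      tDd1 := fun μ ε hε =>
        (hright μ ε hε).2.mono fun a b => kernel_le_z (mul_nonneg (by norm_num) (hKI ε hε)) (hθI ε hε) hδKρ' (hG.dnn a b) }

end OneMember

end

end Literature.MathematicalPhysics.QuantumFieldTheory.Balaban1983to89.B9Thm312WholeDirBC
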